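import Summits.Ventures.PercRepro.SubdivisionC005

/-!
# C-005 is inherited by subdivisions: the base graph's own reduction lifts to the subdivision

Two additions to `SubdivisionC005.lean`.

**Dead edges may be re-attached.** Graphs that agree on the endpoints of every edge open in `ω`
have the same open adjacency, connectivity and partition events at `ω` (`openAdj_congr`,
`conn_congr`, `partitionEvent_congr_of_agree`); since a dead edge (weight `0`) is closed on the support of
the weight, graphs agreeing on the LIVE edges of `p` have the same partition probabilities at `p`
(`prob_partitionEvent_congr_of_live`) and satisfy C-005 together (`C005At_congr_of_live`).

**The lift.** `subdivLift H ℓ` puts the base graph `H` on the subdivision edge type: the edge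
`(e, 0)` is `e` (between `inl` vertices) and the edges `(e, i)`, `i ≥ 1`, are loops at their own
internal vertex; `subdivLiftWeight ℓ q` is `q` on the edges `(e, 0)` and `0` elsewhere. A series
or parallel step of `H` is a step of the lift (`spStep_subdivLift`), so a reduction chain of `H`
lifts (`reduces_subdivLift`). After the subdivision's own chain (`reduces_subdivStage`) the stage
graph agrees with the lift on the live edges, whose weights are the path products `pathProd ℓ p`.

**`C005At_subdivision_of_reduces`**: C-005 at every `p` for every subdivision of every marked
multigraph `H` that series–parallel-reduces, at the path-product weights, to at most eight live
edges — e.g. every subdivision of `K₄` with every edge doubled (`C005At_subdivisionDoubledK4`).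
-/

namespace PercRepro

namespace MultiGraph

open Finset

section Congr

variable {V E : Type}

/-- Graphs agreeing on the endpoints of the edges open in `ω` have the same open adjacency. -/
theorem openAdj_congr {G G' : MultiGraph V E} {ω : Config E}
    (h : ∀ e, ω e = true → G.fst e = G'.fst e ∧ G.snd e = G'.snd e) :
    G.OpenAdj ω = G'.OpenAdj ω := by
  funext a b
  apply propext
  constructor
  · rintro ⟨e, he, hab⟩
    exact ⟨e, he, by rw [← (h e he).1, ← (h e he).2]; exact hab⟩
  · rintro ⟨e, he, hab⟩
    exact ⟨e, he, by rw [(h e he).1, (h e he).2]; exact hab⟩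

/-- Graphs agreeing on the endpoints of the edges open in `ω` have the same connectivity. -/
theorem conn_congr {G G' : MultiGraph V E} {ω : Config E}
    (h : ∀ e, ω e = true → G.fst e = G'.fst e ∧ G.snd e = G'.snd e) :
    G.Conn ω = G'.Conn ω := by
  unfold Conn
  rw [openAdj_congr h]

/-- Graphs agreeing on the endpoints of the edges open in `ω` have the same partition events
at `ω`. -/
theorem partitionEvent_congr_of_agree {G G' : MultiGraph V E} {ω : Config E}
    (h : ∀ e, ω e = true → G.fst e = G'.fst e ∧ G.snd e = G'.snd e) {k : ℕ} (m : Fin k → V)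
    (rgs : Fin k → ℕ) : ω ∈ G.partitionEvent m rgs ↔ ω ∈ G'.partitionEvent m rgs := by
  simp only [partitionEvent, Set.mem_setOf_eq, conn_congr h]

variable [Fintype E] [DecidableEq E]

/-- **The endpoints of dead edges are irrelevant**: graphs agreeing on the live edges of `p`
have the same partition probabilities at `p`. -/
theorem prob_partitionEvent_congr_of_live {G G' : MultiGraph V E} (p : E → ℝ)
    (h : ∀ e, p e ≠ 0 → G.fst e = G'.fst e ∧ G.snd e = G'.snd e) {k : ℕ} (m : Fin k → V)
    (rgs : Fin k → ℕ) : prob p (G.partitionEvent m rgs) = prob p (G'.partitionEvent m rgs) :=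
  prob_congr_of_support p fun ω hw =>
    partitionEvent_congr_of_agree (fun e he => h e fun hpe => by
      rw [eq_false_of_weight_ne_zero_of_eq_zero hw hpe] at he
      exact Bool.false_ne_true he) m rgs

/-- Graphs agreeing on the live edges of `p` satisfy C-005 at `p` together. -/
theorem C005At_congr_of_live {G G' : MultiGraph V E} (p : E → ℝ)
    (h : ∀ e, p e ≠ 0 → G.fst e = G'.fst e ∧ G.snd e = G'.snd e) (a b c d : V) :
    G.C005At p a b c d ↔ G'.C005At p a b c d := by
  unfold C005At
  rw [prob_partitionEvent_congr_of_live p h ![a, b, c, d] ![0, 0, 1, 1],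
    prob_partitionEvent_congr_of_live p h ![a, b, c, d] ![0, 1, 0, 1],
    prob_partitionEvent_congr_of_live p h ![a, b, c, d] ![0, 1, 1, 0],
    prob_partitionEvent_congr_of_live p h ![a, b, c, d] ![0, 0, 0, 0],
    prob_partitionEvent_congr_of_live p h ![a, b, c, d] ![0, 1, 2, 3]]

end Congr

section Lift

variable {V₀ E₀ : Type}

/-- The base graph on the subdivision edge type: the edge `(e, 0)` is `e`, between the `inl`
vertices; every edge `(e, i)` with `i ≥ 1` is a loop at its own internal vertex `(e, i)`. -/
def subdivLift (H : MultiGraph V₀ E₀) (ℓ : E₀ → ℕ) :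
    MultiGraph (V₀ ⊕ (E₀ × ℕ)) (SubdivEdge ℓ) where
  fst x := if (x.2 : ℕ) = 0 then Sum.inl (H.fst x.1) else Sum.inr (x.1, x.2)
  snd x := if (x.2 : ℕ) = 0 then Sum.inl (H.snd x.1) else Sum.inr (x.1, x.2)

/-- A weight vector of the base graph on the subdivision edge type: `q e` on `(e, 0)`, `0` on
the other edges. -/
def subdivLiftWeight (ℓ : E₀ → ℕ) (q : E₀ → ℝ) : SubdivEdge ℓ → ℝ :=
  fun x => if (x.2 : ℕ) = 0 then q x.1 else 0

/-- The product of the weights along the path of `e`. -/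
noncomputable def pathProd (ℓ : E₀ → ℕ) (p : SubdivEdge ℓ → ℝ) (e : E₀) : ℝ :=
  ∏ j ∈ Ico 0 (ℓ e + 1), pathWeight ℓ p e j

variable {H : MultiGraph V₀ E₀} {ℓ : E₀ → ℕ}

/-- The `0`-edge of `e` starts at the first endpoint of `e`. -/
theorem subdivLift_fst_zero (e : E₀) : (subdivLift H ℓ).fst ⟨e, 0⟩ = Sum.inl (H.fst e) := by
  simp [subdivLift]

/-- The `0`-edge of `e` ends at the second endpoint of `e`. -/
theorem subdivLift_snd_zero (e : E₀) : (subdivLift H ℓ).snd ⟨e, 0⟩ = Sum.inl (H.snd e) := by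
  simp [subdivLift]

/-- The lifted weight of the `0`-edge of `e` is `q e`. -/
theorem subdivLiftWeight_zero (q : E₀ → ℝ) (e : E₀) : subdivLiftWeight ℓ q ⟨e, 0⟩ = q e := by
  simp [subdivLiftWeight]

/-- Edges with different indices are different, whatever their paths. -/
theorem subdivEdge_ne_of_val_ne {e e' : E₀} {i : Fin (ℓ e + 1)} {i' : Fin (ℓ e' + 1)}
    (h : (i : ℕ) ≠ i') : (⟨e, i⟩ : SubdivEdge ℓ) ≠ ⟨e', i'⟩ := by
  intro h'
  obtain ⟨rfl, h2⟩ := Sigma.mk.inj_iff.1 h'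
  exact h (congrArg Fin.val (eq_of_heq h2))

/-- The lifted weight of a probability vector is a probability vector. -/
theorem isProb_subdivLiftWeight {q : E₀ → ℝ} (hq : IsProb q) :
    IsProb (subdivLiftWeight ℓ q) := by
  intro x
  unfold subdivLiftWeight
  split_ifs
  · exact hq _
  · exact ⟨le_rfl, zero_le_one⟩

/-- The live edges of a lifted weight are the lifted live edges. -/
theorem card_liveEdges_subdivLiftWeight_le [Fintype E₀] [DecidableEq E₀] (q : E₀ → ℝ) :
    (liveEdges (subdivLiftWeight ℓ q)).card ≤ (liveEdges q).card := by
  have hsub : liveEdges (subdivLiftWeight ℓ q) ⊆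
      (liveEdges q).image fun e : E₀ => (⟨e, 0⟩ : SubdivEdge ℓ) := by
    intro x hx
    rw [mem_liveEdges] at hx
    obtain ⟨e, i⟩ := x
    unfold subdivLiftWeight at hx
    split_ifs at hx with hi
    · refine mem_image.2 ⟨e, mem_liveEdges.2 hx, subdivEdge_mk_eq_iff.2 ?_⟩
      simpa using hi.symm
    · exact absurd rfl hx
  exact (card_le_card hsub).trans card_image_le

/-- The stage weight after the full chain is the lifted path-product weight. -/
theorem subdivWeight_top (p : SubdivEdge ℓ → ℝ) :
    subdivWeight ℓ p ℓ = subdivLiftWeight ℓ (pathProd ℓ p) := by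
  funext x
  obtain ⟨e, i⟩ := x
  by_cases hi : (i : ℕ) = 0
  · rw [subdivWeight_of_eq p ℓ (by rw [Nat.sub_self]; exact hi), hi]
    simp [subdivLiftWeight, pathProd, hi]
  · rw [subdivWeight_of_gt p ℓ (by rw [Nat.sub_self]; omega)]
    simp [subdivLiftWeight, hi]

/-- After the full chain the stage graph agrees with the lift on the live edges. -/
theorem subdivStage_top_agree (H : MultiGraph V₀ E₀) (ℓ : E₀ → ℕ) (q : E₀ → ℝ) :
    ∀ x : SubdivEdge ℓ, subdivLiftWeight ℓ q x ≠ 0 →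
      (subdivStage H ℓ ℓ).fst x = (subdivLift H ℓ).fst x ∧
        (subdivStage H ℓ ℓ).snd x = (subdivLift H ℓ).snd x := by
  rintro ⟨e, i⟩ hx
  simp only [subdivLiftWeight] at hx
  split_ifs at hx with hi
  · have hi0 : i = 0 := Fin.ext hi
    subst hi0
    simp [subdivStage, subdivLift, subdivVtx]
  · exact absurd rfl hx

/-- A series vertex of `H` is a series vertex of the lift. -/
theorem isSeries_subdivLift {e₁ e₂ : E₀} {x y z : V₀} (hs : H.IsSeries e₁ e₂ x y z) :
    (subdivLift H ℓ).IsSeries ⟨e₁, 0⟩ ⟨e₂, 0⟩ (Sum.inl x) (Sum.inl y) (Sum.inl z) := by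
  refine ⟨subdivEdge_mk_ne hs.ne, ?_, ?_, ?_, ?_, ?_⟩
  · rcases hs.end₁ with ⟨h1, h2⟩ | ⟨h1, h2⟩
    · left
      simp [subdivLift, h1, h2]
    · right
      simp [subdivLift, h1, h2]
  · rcases hs.end₂ with ⟨h1, h2⟩ | ⟨h1, h2⟩
    · left
      simp [subdivLift, h1, h2]
    · right
      simp [subdivLift, h1, h2]
  · intro h
    exact hs.yx (Sum.inl_injective h)
  · intro h
    exact hs.zx (Sum.inl_injective h)
  · rintro ⟨e', i'⟩ h
    by_cases hi : i' = 0
    · subst hi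
      simp only [subdivLift_fst_zero, subdivLift_snd_zero, Sum.inl.injEq] at h
      rcases hs.deg e' h with rfl | rfl
      · exact Or.inl rfl
      · exact Or.inr rfl
    · exfalso
      simp [subdivLift, hi] at h

/-- The series substitution commutes with the lift. -/
theorem seriesGraph_subdivLift [DecidableEq E₀] (H : MultiGraph V₀ E₀) (ℓ : E₀ → ℕ) (e₁ : E₀)
    (y z : V₀) :
    (subdivLift H ℓ).seriesGraph ⟨e₁, 0⟩ (Sum.inl y) (Sum.inl z) =
      subdivLift (H.seriesGraph e₁ y z) ℓ := by
  unfold seriesGraph subdivLift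
  congr 1
  · funext x
    obtain ⟨e', i'⟩ := x
    rw [Function.update_apply]
    by_cases he : e₁ = e'
    · subst he
      by_cases hi : (i' : ℕ) = 0
      · rw [if_pos (subdivEdge_mk_eq_iff.2 (by simpa using hi))]
        simp [hi]
      · rw [if_neg (subdivEdge_mk_ne_of_ne (by simpa using hi))]
        simp [hi]
    · rw [if_neg (subdivEdge_mk_ne (Ne.symm he))]
      simp [Function.update_of_ne (Ne.symm he)]
  · funext x
    obtain ⟨e', i'⟩ := x
    rw [Function.update_apply]
    by_cases he : e₁ = e'
    · subst he
      by_cases hi : (i' : ℕ) = 0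
      · rw [if_pos (subdivEdge_mk_eq_iff.2 (by simpa using hi))]
        simp [hi]
      · rw [if_neg (subdivEdge_mk_ne_of_ne (by simpa using hi))]
        simp [hi]
    · rw [if_neg (subdivEdge_mk_ne (Ne.symm he))]
      simp [Function.update_of_ne (Ne.symm he)]

/-- Updating the lifted weight on two `0`-edges is the lift of the updated weight. -/
theorem subdivLiftWeight_update₂ [DecidableEq E₀] (ℓ : E₀ → ℕ) (q : E₀ → ℝ) (e₁ e₂ : E₀) (t : ℝ) :
    Function.update (Function.update (subdivLiftWeight ℓ q) ⟨e₂, 0⟩ 0) ⟨e₁, 0⟩ t =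
      subdivLiftWeight ℓ (Function.update (Function.update q e₂ 0) e₁ t) := by
  funext x
  obtain ⟨e', i'⟩ := x
  by_cases hi : (i' : ℕ) = 0
  · have hi0 : i' = 0 := Fin.ext hi
    subst hi0
    rw [subdivLiftWeight_zero]
    by_cases h1 : e' = e₁
    · subst h1
      rw [Function.update_self, Function.update_self]
    · rw [Function.update_of_ne (subdivEdge_mk_ne h1), Function.update_of_ne h1]
      by_cases h2 : e' = e₂
      · subst h2
        rw [Function.update_self, Function.update_self]
      · rw [Function.update_of_ne (subdivEdge_mk_ne h2), Function.update_of_ne h2,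
          subdivLiftWeight_zero]
  · rw [Function.update_of_ne (subdivEdge_ne_of_val_ne (by simpa using hi)),
      Function.update_of_ne (subdivEdge_ne_of_val_ne (by simpa using hi))]
    simp [subdivLiftWeight, hi]

/-- The series substitution of weights commutes with the lift. -/
theorem serWeight_subdivLiftWeight [DecidableEq E₀] (ℓ : E₀ → ℕ) (q : E₀ → ℝ) (e₁ e₂ : E₀) :
    serWeight (subdivLiftWeight ℓ q) ⟨e₁, 0⟩ ⟨e₂, 0⟩ = subdivLiftWeight ℓ (serWeight q e₁ e₂) := by
  unfold serWeight
  rw [subdivLiftWeight_zero, subdivLiftWeight_zero, subdivLiftWeight_update₂]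

/-- The parallel substitution of weights commutes with the lift. -/
theorem parWeight_subdivLiftWeight [DecidableEq E₀] (ℓ : E₀ → ℕ) (q : E₀ → ℝ) (e₁ e₂ : E₀) :
    parWeight (subdivLiftWeight ℓ q) ⟨e₁, 0⟩ ⟨e₂, 0⟩ = subdivLiftWeight ℓ (parWeight q e₁ e₂) := by
  unfold parWeight
  rw [subdivLiftWeight_zero, subdivLiftWeight_zero, subdivLiftWeight_update₂]

/-- Parallel edges of `H` are parallel in the lift. -/
theorem parallel_subdivLift {e₁ e₂ : E₀} (h : H.Parallel e₁ e₂) :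
    (subdivLift H ℓ).Parallel ⟨e₁, 0⟩ ⟨e₂, 0⟩ := by
  unfold Parallel at h ⊢
  simp only [subdivLift_fst_zero, subdivLift_snd_zero, Sum.inl.injEq]
  exact h

variable [DecidableEq E₀]

/-- **A reduction step of the base graph is a reduction step of its lift.** -/
theorem spStep_subdivLift (ℓ : E₀ → ℕ) {a b c d : V₀} {x y : MultiGraph V₀ E₀ × (E₀ → ℝ)}
    (h : SPStep a b c d x y) :
    SPStep (Sum.inl a) (Sum.inl b) (Sum.inl c) (Sum.inl d)
      (subdivLift x.1 ℓ, subdivLiftWeight ℓ x.2) (subdivLift y.1 ℓ, subdivLiftWeight ℓ y.2) := by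
  cases h with
  | @series G p e₁ e₂ x y z hs hx =>
    have h := SPStep.series (a := Sum.inl a) (b := Sum.inl b) (c := Sum.inl c) (d := Sum.inl d)
      (p := subdivLiftWeight ℓ p) (isSeries_subdivLift (ℓ := ℓ) hs) (by simpa using hx)
    rwa [seriesGraph_subdivLift, serWeight_subdivLiftWeight] at h
  | @parallel G p e₁ e₂ hne hpar =>
    have h := SPStep.parallel (a := Sum.inl a) (b := Sum.inl b) (c := Sum.inl c) (d := Sum.inl d)
      (G := subdivLift G ℓ) (p := subdivLiftWeight ℓ p) (subdivEdge_mk_ne hne)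
      (parallel_subdivLift (ℓ := ℓ) hpar)
    rwa [parWeight_subdivLiftWeight] at h

/-- **A reduction chain of the base graph lifts to the subdivision edge type.** -/
theorem reduces_subdivLift (ℓ : E₀ → ℕ) {a b c d : V₀} {x y : MultiGraph V₀ E₀ × (E₀ → ℝ)}
    (h : Reduces a b c d x y) :
    Reduces (Sum.inl a) (Sum.inl b) (Sum.inl c) (Sum.inl d)
      (subdivLift x.1 ℓ, subdivLiftWeight ℓ x.2) (subdivLift y.1 ℓ, subdivLiftWeight ℓ y.2) :=
  Relation.ReflTransGen.lift (r := SPStep a b c d)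
    (p := SPStep (Sum.inl a) (Sum.inl b) (Sum.inl c) (Sum.inl d))
    (fun x : MultiGraph V₀ E₀ × (E₀ → ℝ) => (subdivLift x.1 ℓ, subdivLiftWeight ℓ x.2))
    (fun _ _ hxy => spStep_subdivLift ℓ hxy) x y h

variable [Fintype E₀]

/-- **C-005 is inherited by subdivisions of reducible networks**: if the base graph `H`, weighted
by the path products of `p`, series–parallel-reduces to at most eight live edges, then every
subdivision `H.subdivision ℓ` satisfies C-005 at `p` for the marks `a, b, c, d` of `H`. -/
theorem C005At_subdivision_of_reduces (H : MultiGraph V₀ E₀) (ℓ : E₀ → ℕ) (p : SubdivEdge ℓ → ℝ)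
    (hp : IsProb p) {a b c d : V₀} {H' : MultiGraph V₀ E₀} {q' : E₀ → ℝ}
    (h : Reduces a b c d (H, pathProd ℓ p) (H', q')) (hlive : (liveEdges q').card ≤ 8) :
    (H.subdivision ℓ).C005At p (Sum.inl a) (Sum.inl b) (Sum.inl c) (Sum.inl d) := by
  have hp0 : IsProb (subdivWeight ℓ p 0) := by rwa [subdivWeight_zero]
  have hchain := reduces_subdivStage (H := H) p a b c d ℓ fun e => le_rfl
  have hpℓ : IsProb (subdivLiftWeight ℓ (pathProd ℓ p)) := by
    rw [← subdivWeight_top]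
    exact hchain.isProb hp0
  have hlift := reduces_subdivLift ℓ h
  have h1 : (subdivLift H' ℓ).C005At (subdivLiftWeight ℓ q') (Sum.inl a) (Sum.inl b) (Sum.inl c)
      (Sum.inl d) :=
    C005At_of_card_liveEdges_le_eight _ (hlift.isProb hpℓ)
      ((card_liveEdges_subdivLiftWeight_le q').trans hlive) _ _ _ _
  have h2 := C005At_of_reduces' hlift h1
  have h3 : (subdivStage H ℓ ℓ).C005At (subdivWeight ℓ p ℓ) (Sum.inl a) (Sum.inl b) (Sum.inl c)
      (Sum.inl d) := by
    rw [subdivWeight_top]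
    exact (C005At_congr_of_live _ (subdivStage_top_agree H ℓ (pathProd ℓ p)) _ _ _ _).2 h2
  have h4 := C005At_of_reduces' hchain h3
  rwa [subdivStage_zero, subdivWeight_zero] at h4

end Lift

section DoubledK4

/-- `K₄` with every edge doubled: edges `k` and `k + 6` join the `k`-th pair of terminals. -/
def doubledK4 : MultiGraph (Fin 4) (Fin 12) where
  fst := ![0, 0, 0, 1, 1, 2, 0, 0, 0, 1, 1, 2]
  snd := ![1, 2, 3, 2, 3, 3, 1, 2, 3, 2, 3, 3]

/-- `Parallel` is decidable on finite types. -/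
instance {V E : Type} [DecidableEq V] (G : MultiGraph V E) (e₁ e₂ : E) :
    Decidable (G.Parallel e₁ e₂) :=
  inferInstanceAs (Decidable (_ ∨ _))

/-- The weight after merging the six parallel pairs. -/
noncomputable def doubledK4.reducedWeight (q : Fin 12 → ℝ) : Fin 12 → ℝ :=
  parWeight (parWeight (parWeight (parWeight (parWeight (parWeight q 0 6) 1 7) 2 8) 3 9) 4 10) 5 11

/-- Six parallel steps reduce the doubled `K₄` to six live edges. -/
theorem doubledK4_reduces (q : Fin 12 → ℝ) :
    Reduces (0 : Fin 4) 1 2 3 (doubledK4, q) (doubledK4, doubledK4.reducedWeight q) := by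
  unfold Reduces
  refine Relation.ReflTransGen.head (SPStep.parallel (e₁ := 0) (e₂ := 6) (by decide) (by decide)) ?_
  refine Relation.ReflTransGen.head (SPStep.parallel (e₁ := 1) (e₂ := 7) (by decide) (by decide)) ?_
  refine Relation.ReflTransGen.head (SPStep.parallel (e₁ := 2) (e₂ := 8) (by decide) (by decide)) ?_
  refine Relation.ReflTransGen.head (SPStep.parallel (e₁ := 3) (e₂ := 9) (by decide) (by decide)) ?_
  refine Relation.ReflTransGen.head
    (SPStep.parallel (e₁ := 4) (e₂ := 10) (by decide) (by decide)) ?_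
  refine Relation.ReflTransGen.head
    (SPStep.parallel (e₁ := 5) (e₂ := 11) (by decide) (by decide)) ?_
  exact Relation.ReflTransGen.refl

/-- After the six parallel steps the edges `6, …, 11` are dead. -/
theorem doubledK4.reducedWeight_ge_six (q : Fin 12 → ℝ) :
    ∀ e : Fin 12, 6 ≤ e.val → doubledK4.reducedWeight q e = 0 := by
  intro e he
  unfold doubledK4.reducedWeight parWeight
  fin_cases e <;> simp at he ⊢

/-- At most six edges are live after the six parallel steps. -/
theorem doubledK4.card_liveEdges_reducedWeight_le (q : Fin 12 → ℝ) :
    (liveEdges (doubledK4.reducedWeight q)).card ≤ 8 := by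
  classical
  have hsub : liveEdges (doubledK4.reducedWeight q) ⊆
      Finset.univ.filter fun e : Fin 12 => e.val < 6 := by
    intro e he
    rw [mem_liveEdges] at he
    refine Finset.mem_filter.2 ⟨Finset.mem_univ _, ?_⟩
    by_contra h
    exact he (doubledK4.reducedWeight_ge_six q e (by omega))
  refine (Finset.card_le_card hsub).trans ?_
  decide

/-- **C-005 for every subdivision of the doubled `K₄` at every `p`**: twelve terminal paths of
arbitrary lengths, two between each pair of terminals. -/
theorem C005At_subdivisionDoubledK4 (ℓ : Fin 12 → ℕ) (p : SubdivEdge ℓ → ℝ) (hp : IsProb p) :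
    (doubledK4.subdivision ℓ).C005At p (Sum.inl 0) (Sum.inl 1) (Sum.inl 2) (Sum.inl 3) :=
  C005At_subdivision_of_reduces doubledK4 ℓ p hp (doubledK4_reduces (pathProd ℓ p))
    (doubledK4.card_liveEdges_reducedWeight_le _)

end DoubledK4

end MultiGraph

end PercRepro
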